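import Summits.AtomisticToContinuum.BoseEinsteinCondensation.Theses.BECInsertionCorrector
import Summits.AtomisticToContinuum.BoseEinsteinCondensation.Theorems.StaticResponseBound.Negative.Basic
import Summits.AtomisticToContinuum.BoseEinsteinCondensation.Theorems.BECInsertionCorrectorStaticResponseBoundSectorDecompositionFibre
import Summits.AtomisticToContinuum.BoseEinsteinCondensation.Theorems.BECInsertionCorrectorStaticResponseBoundSectorDecompositionMeasure
import Literature.MathematicalPhysics.QuantumManyBody.BoseGasStructureFactor
import Literature.MathematicalPhysics.QuantumManyBody.PeriodicBoseGasMomentumSector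
import HarnessLib

/-!
# The sector (Bloch / centre-of-mass) decomposition of a periodic `C¹` state — stub C2α

Helper file for the crux `BECInsertionCorrector.StaticResponseBound` (item
stmt-AtomisticToContinuum-12057), line `stable-fraction-square-completion`: the registered stub
**C2α** `stub_sectorDecomposition`, statement verbatim from the checked skeleton
`Cruxes/StaticResponseBound/Lines/stable-fraction-square-completion.lean`.

For a periodic `C¹` `N`-body state `Ψ` on the torus of side `L` and `q ∈ ℤ³` the sector component is
`Φc q X = ĉ_q(s ↦ Ψ(X + s𝟙)) = L⁻³ ∫_{[0,L)³} e^{-2πi q·s/L} Ψ(x₁ + s, …, x_N + s) ds`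
(the `q`-th Fourier coefficient of the centre-of-mass fibre map).  From the two helper files
(`…SectorDecompositionFibre`: Bloch property, `C¹` regularity, fibrewise Parseval identities;
`…SectorDecompositionMeasure`: cell integrals of fibre averages against ARBITRARY periodic,
diagonal-invariant weights — the stub quantifies over all `v : ℝ → ℝ≥0∞`, so
`periodicInteraction v L` need not be measurable) we assemble: regularity, periodicity, Bose
symmetry, total momentum `2πq/L`, Parseval for the norm (`∑_q ‖Φc q‖² = 1`), for the energy form
including the interaction in `[0,∞]` (`∑_q ⟨Φc q, HΦc q⟩ = ⟨Ψ, HΨ⟩`), and the density-wave pairing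
`∑_q ⟨Φc (q+k), ρ̂_k Φc q⟩ = ⟨Ψ, ρ̂_k Ψ⟩` (dominated convergence over the cell, then Fubini and the
cell shift).  No new definitions.
-/

namespace Summit.AtomisticToContinuum.BoseEinsteinCondensation.Cruxes.StaticResponseBound.StableFractionSquareCompletion

open MeasureTheory Filter
open scoped ENNReal ComplexConjugate Topology
open Literature.MathematicalPhysics.QuantumManyBody.BoseGas
open Summit.AtomisticToContinuum.BoseEinsteinCondensation.Theses
open Summit.AtomisticToContinuum.BoseEinsteinCondensation.Theorems.StaticResponseBound.Negative

noncomputable section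

variable {N : ℕ} {L : ℝ}

/-! ### A bookkeeping lemma on the kinetic density -/

/-- A bound on the derivative bounds the kinetic density (by a finite constant). [folklore] -/
theorem secdec_kineticDensity_le {ψ : Config N → ℂ} {C : ℝ} (hC : ∀ X, ‖fderiv ℝ ψ X‖ ≤ C)
    (X : Config N) :
    kineticDensity ψ X ≤ ∑ i : Fin N, ∑ a : Fin 3, ENNReal.ofReal
      ((C * ‖(Pi.single i (EuclideanSpace.single a (1 : ℝ)) : Config N)‖) ^ 2) := by
  unfold kineticDensity
  refine Finset.sum_le_sum fun i _ => Finset.sum_le_sum fun a _ => ?_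
  rw [coe_nnnorm_sq_eq_ofReal]
  refine ENNReal.ofReal_le_ofReal (pow_le_pow_left₀ (norm_nonneg _) ?_ 2)
  exact (ContinuousLinearMap.le_opNorm _ _).trans
    (mul_le_mul_of_nonneg_right (hC X) (norm_nonneg _))

/-! ### The registered stub -/
set_option maxHeartbeats 400000 in
/-- **C2α `stub_sectorDecomposition`** (statement verbatim from the checked skeleton of the line
`stable-fraction-square-completion`): every periodic `C¹` `N`-body state on the torus of side
`L > 0` has a family of sector components `Φc q`, `q ∈ ℤ³` — `C¹`, `Lℤ³`-periodic in every particle,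
Bose-symmetric, of total momentum `2πq/L` — with Parseval for the norm, for the energy form
including the (arbitrary, possibly non-measurable, hard-core) interaction in `[0,∞]`, and for the
density-wave pairing.  Witness: `Φc q X = L⁻³∫_{[0,L)³} e^{-2πi q·s/L} Ψ(X + s𝟙) ds`. [folklore] -/
theorem stub_sectorDecomposition :
    ∀ (v : ℝ → ℝ≥0∞) (N : ℕ) (L : ℝ), 0 < L → ∀ (k : Fin 3 → ℤ) (Ψ : PeriodicTrialState N L),
      ∃ Φc : (Fin 3 → ℤ) → Config N → ℂ,
        (∀ q, ContDiff ℝ 1 (Φc q)) ∧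
        (∀ q (X : Config N) (i : Fin N) (a : Fin 3),
          Φc q (X + Pi.single i (EuclideanSpace.single a L)) = Φc q X) ∧
        (∀ q (σ : Equiv.Perm (Fin N)) (X : Config N), Φc q (X ∘ σ) = Φc q X) ∧
        (∀ q, HasTotalMomentum
          ((2 * Real.pi / L) • (WithLp.toLp 2 fun t => (q t : ℝ) : EuclideanSpace ℝ (Fin 3))) (Φc q)) ∧
        (∑' q, ∫⁻ X in cellN N L, (‖Φc q X‖₊ : ℝ≥0∞) ^ 2) = 1 ∧
        (∑' q, ∫⁻ X in cellN N L,
            (kineticDensity (Φc q) X + periodicInteraction v L X * (‖Φc q X‖₊ : ℝ≥0∞) ^ 2)) =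
          periodicEnergy v Ψ ∧
        HasSum (fun q : Fin 3 → ℤ =>
            ∫ X in cellN N L, conj (Φc (q + k) X) * (densityWave N L k X * Φc q X))
          (∫ X in cellN N L, densityWave N L k X * (((‖Ψ.ψ X‖ ^ 2 : ℝ)) : ℂ)) := by
  intro v N L hL k Ψ
  -- the witness: the sector components `Φc q X = ĉ_q(s ↦ Ψ(X + s𝟙))`
  set Φc : (Fin 3 → ℤ) → Config N → ℂ :=
    fun q X => cellFourierCoeff L (fun s => Ψ.ψ (X + fun _ => s)) q with hΦc
  have hper : IsTorusPeriodic L Ψ.ψ := Ψ.periodic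
  have hcont : Continuous Ψ.ψ := Ψ.contDiff.continuous
  have hC1 : ∀ q, ContDiff ℝ 1 (Φc q) := fun q => secdec_contDiff hL Ψ.contDiff hper q
  have hcontq : ∀ q, Continuous (Φc q) := fun q => (hC1 q).continuous
  have hg : ∀ X, Continuous fun s : Space => Ψ.ψ (X + fun _ => s) := fun X =>
    secdec_fibre_continuous hcont X
  -- measurability, periodicity and boundedness of the densities
  have hρqm : ∀ q, Measurable fun X => ((‖Φc q X‖₊ : ℝ≥0∞) ^ 2) := fun q =>
    (hcontq q).measurable.nnnorm.coe_nnreal_ennreal.pow_const 2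
  have hρm : Measurable fun X => ((‖Ψ.ψ X‖₊ : ℝ≥0∞) ^ 2) :=
    hcont.measurable.nnnorm.coe_nnreal_ennreal.pow_const 2
  have hρper : IsTorusPeriodic L fun X => ((‖Ψ.ψ X‖₊ : ℝ≥0∞) ^ 2) := fun X i a => by
    show ((‖Ψ.ψ (X + _)‖₊ : ℝ≥0∞) ^ 2) = ((‖Ψ.ψ X‖₊ : ℝ≥0∞) ^ 2)
    rw [hper]
  obtain ⟨CΨ, hCΨ⟩ := secdec_exists_bound hL hcont hper
  have hρle : ∀ X, ((‖Ψ.ψ X‖₊ : ℝ≥0∞) ^ 2) ≤ ENNReal.ofReal (CΨ ^ 2) := fun X => by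
    rw [coe_nnnorm_sq_eq_ofReal]
    exact ENNReal.ofReal_le_ofReal (pow_le_pow_left₀ (norm_nonneg _) (hCΨ X) 2)
  have hL3 : ENNReal.ofReal L ^ 3 ≠ 0 := pow_ne_zero _ (ENNReal.ofReal_pos.2 hL).ne'
  -- fibrewise Parseval for the norm, pointwise in `X`
  have hPars : ∀ X, ∑' q, ((‖Φc q X‖₊ : ℝ≥0∞) ^ 2) =
      (ENNReal.ofReal L ^ 3)⁻¹ * ∫⁻ s in cell L, ((‖Ψ.ψ (X + fun _ => s)‖₊ : ℝ≥0∞) ^ 2) :=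
    fun X => secdec_tsum_sq hL hcont X
  have hfinX : ∀ X, (ENNReal.ofReal L ^ 3)⁻¹ *
      ∫⁻ s in cell L, ((‖Ψ.ψ (X + fun _ => s)‖₊ : ℝ≥0∞) ^ 2) < ⊤ := fun X => by
    refine ENNReal.mul_lt_top (ENNReal.inv_ne_top.2 hL3).lt_top ?_
    calc ∫⁻ s in cell L, ((‖Ψ.ψ (X + fun _ => s)‖₊ : ℝ≥0∞) ^ 2)
        ≤ ∫⁻ _ in cell L, ENNReal.ofReal (CΨ ^ 2) := lintegral_mono fun s => hρle _
      _ < ⊤ := by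
          rw [setLIntegral_const, volume_cell]
          exact ENNReal.mul_lt_top ENNReal.ofReal_lt_top (ENNReal.pow_lt_top ENNReal.ofReal_lt_top)
  refine ⟨Φc, hC1, fun q X i a => secdec_isTorusPeriodic hper q X i a,
    fun q σ X => secdec_symm Ψ.symm q σ X, fun q => secdec_hasTotalMomentum hL hper q,
    ?_, ?_, ?_⟩
  · -- Parseval for the norm
    calc ∑' q, ∫⁻ X in cellN N L, ((‖Φc q X‖₊ : ℝ≥0∞) ^ 2)
        = ∫⁻ X in cellN N L, ∑' q, ((‖Φc q X‖₊ : ℝ≥0∞) ^ 2) :=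
          (lintegral_tsum fun q => (hρqm q).aemeasurable).symm
      _ = ∫⁻ X in cellN N L, 1 * ((ENNReal.ofReal L ^ 3)⁻¹ *
            ∫⁻ s in cell L, ((‖Ψ.ψ (X + fun _ => s)‖₊ : ℝ≥0∞) ^ 2)) :=
          lintegral_congr fun X => by rw [one_mul, hPars]
      _ = ∫⁻ X in cellN N L, 1 * ((‖Ψ.ψ X‖₊ : ℝ≥0∞) ^ 2) :=
          secdec_lintegral_mul_fibre_average N L hL (fun _ => 1) (fun _ _ _ => rfl)
            (fun _ _ => rfl) _ hρm hρper _ ENNReal.ofReal_ne_top hρle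
      _ = 1 := by simp_rw [one_mul]; exact Ψ.norm_eq
  · -- Parseval for the energy form
    have hkinq_m : ∀ q, Measurable (kineticDensity (Φc q)) := fun q =>
      measurable_kineticDensity (hC1 q)
    have hkin_m : Measurable (kineticDensity Ψ.ψ) := measurable_kineticDensity Ψ.contDiff
    have hkin_per : IsTorusPeriodic L (kineticDensity Ψ.ψ) := fun X i a =>
      Ψ.kineticDensity_add_single X i a
    obtain ⟨CD, hCD⟩ := secdec_exists_bound hL (Ψ.contDiff.continuous_fderiv one_ne_zero)
      (secdec_isTorusPeriodic_fderiv hper)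
    have hkin_le := secdec_kineticDensity_le hCD
    have hWper : IsTorusPeriodic L (periodicInteraction v L : Config N → ℝ≥0∞) := fun X i a =>
      periodicInteraction_add_single v L X i a
    have hWdiag : ∀ (X : Config N) (s : Space),
        periodicInteraction v L (X + fun _ => s) = periodicInteraction v L X := fun X s =>
      periodicInteraction_add_const v L X s
    have hsplit : ∀ q, ∫⁻ X in cellN N L, (kineticDensity (Φc q) X +
        periodicInteraction v L X * ((‖Φc q X‖₊ : ℝ≥0∞) ^ 2)) =
        (∫⁻ X in cellN N L, kineticDensity (Φc q) X) +
          ∫⁻ X in cellN N L, periodicInteraction v L X * ((‖Φc q X‖₊ : ℝ≥0∞) ^ 2) := fun q =>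
      lintegral_add_left (hkinq_m q) _
    have hkin : ∑' q, ∫⁻ X in cellN N L, kineticDensity (Φc q) X =
        ∫⁻ X in cellN N L, kineticDensity Ψ.ψ X := by
      calc ∑' q, ∫⁻ X in cellN N L, kineticDensity (Φc q) X
          = ∫⁻ X in cellN N L, ∑' q, kineticDensity (Φc q) X :=
            (lintegral_tsum fun q => (hkinq_m q).aemeasurable).symm
        _ = ∫⁻ X in cellN N L, 1 * ((ENNReal.ofReal L ^ 3)⁻¹ *
              ∫⁻ s in cell L, kineticDensity Ψ.ψ (X + fun _ => s)) :=
            lintegral_congr fun X => by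
              rw [one_mul]
              exact secdec_tsum_kineticDensity N L hL Ψ.ψ Ψ.contDiff hper X
        _ = ∫⁻ X in cellN N L, 1 * kineticDensity Ψ.ψ X :=
            secdec_lintegral_mul_fibre_average N L hL (fun _ => 1) (fun _ _ _ => rfl)
              (fun _ _ => rfl) _ hkin_m hkin_per _ (ENNReal.sum_ne_top.2 fun i _ =>
                ENNReal.sum_ne_top.2 fun a _ => ENNReal.ofReal_ne_top) hkin_le
        _ = ∫⁻ X in cellN N L, kineticDensity Ψ.ψ X := by simp_rw [one_mul]
    have hpot : ∑' q, ∫⁻ X in cellN N L, periodicInteraction v L X * ((‖Φc q X‖₊ : ℝ≥0∞) ^ 2) =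
        ∫⁻ X in cellN N L, periodicInteraction v L X * ((‖Ψ.ψ X‖₊ : ℝ≥0∞) ^ 2) := by
      have hfin : ∀ X, ∑' q, ((‖Φc q X‖₊ : ℝ≥0∞) ^ 2) < ⊤ := fun X => by
        rw [hPars]
        exact hfinX X
      rw [secdec_tsum_lintegral_mul _ (periodicInteraction v L) hρqm hfin]
      calc ∫⁻ X in cellN N L, periodicInteraction v L X * ∑' q, ((‖Φc q X‖₊ : ℝ≥0∞) ^ 2)
          = ∫⁻ X in cellN N L, periodicInteraction v L X * ((ENNReal.ofReal L ^ 3)⁻¹ *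
              ∫⁻ s in cell L, ((‖Ψ.ψ (X + fun _ => s)‖₊ : ℝ≥0∞) ^ 2)) :=
            lintegral_congr fun X => by rw [hPars]
        _ = _ := secdec_lintegral_mul_fibre_average N L hL (periodicInteraction v L) hWper hWdiag
              _ hρm hρper _ ENNReal.ofReal_ne_top hρle
    simp_rw [hsplit]
    rw [ENNReal.tsum_add, hkin, hpot]
    unfold periodicEnergy
    exact (lintegral_add_left hkin_m _).symm
  · -- Parseval for the density-wave pairing
    haveI hμfin : IsFiniteMeasure (volume.restrict (cellN N L) : Measure (Config N)) := by
      refine ⟨?_⟩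
      rw [Measure.restrict_apply_univ, volume_cellN]
      exact ENNReal.pow_lt_top (ENNReal.pow_lt_top ENNReal.ofReal_lt_top)
    haveI hνfin : IsFiniteMeasure (volume.restrict (cell L) : Measure Space) := by
      refine ⟨?_⟩
      rw [Measure.restrict_apply_univ, volume_cell]
      exact ENNReal.pow_lt_top ENNReal.ofReal_lt_top
    -- pointwise: the polarised Parseval identity, multiplied by `ρ̂_k(X)`
    have hpt : ∀ X, HasSum (fun q => conj (Φc (q + k) X) * (densityWave N L k X * Φc q X))
        (densityWave N L k X * (((L ^ 3)⁻¹ : ℝ) • ∫ s in cell L,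
          cellWave L k s * (((‖Ψ.ψ (X + fun _ => s)‖ ^ 2 : ℝ)) : ℂ))) := fun X => by
      refine ((secdec_hasSum_conj_mul hL (hg X) k).mul_left (densityWave N L k X)).congr_fun
        fun q => ?_
      simp only [hΦc]
      ring
    -- the dominating summable bound `N (‖Φc (q+k) X‖² + ‖Φc q X‖²)`
    have hsq : ∀ X, HasSum (fun q => ‖Φc q X‖ ^ 2)
        ((L ^ 3)⁻¹ * ∫ s in cell L, ‖Ψ.ψ (X + fun _ => s)‖ ^ 2) := fun X =>
      hasSum_sq_cellFourierCoeff hL (hg X)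
    have hsqk : ∀ X, HasSum (fun q => ‖Φc (q + k) X‖ ^ 2)
        ((L ^ 3)⁻¹ * ∫ s in cell L, ‖Ψ.ψ (X + fun _ => s)‖ ^ 2) := fun X =>
      (Equiv.addRight k).hasSum_iff.2 (hsq X)
    have hbound : ∀ q X, ‖conj (Φc (q + k) X) * (densityWave N L k X * Φc q X)‖ ≤
        N * (‖Φc (q + k) X‖ ^ 2 + ‖Φc q X‖ ^ 2) := fun q X => by
      rw [norm_mul, norm_mul, RCLike.norm_conj]
      have ha := norm_nonneg (Φc (q + k) X)
      have hb := norm_nonneg (Φc q X)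
      have hd := norm_densityWave_le L k X
      have hd0 := norm_nonneg (densityWave N L k X)
      nlinarith [mul_nonneg ha hb, sq_nonneg (‖Φc (q + k) X‖ - ‖Φc q X‖),
        mul_le_mul_of_nonneg_right hd (mul_nonneg ha hb)]
    have hsummable : ∀ X, Summable fun q => (N : ℝ) * (‖Φc (q + k) X‖ ^ 2 + ‖Φc q X‖ ^ 2) :=
      fun X => ((hsqk X).add (hsq X)).summable.mul_left _
    -- the fibre mass `T X = L⁻³ ∫_{cell} ‖Ψ(X + s𝟙)‖²` is continuous and bounded
    set T : Config N → ℝ := fun X => (L ^ 3)⁻¹ * ∫ s in cell L, ‖Ψ.ψ (X + fun _ => s)‖ ^ 2 with hT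
    have htsum : ∀ X, ∑' q, (N : ℝ) * (‖Φc (q + k) X‖ ^ 2 + ‖Φc q X‖ ^ 2) = N * (T X + T X) :=
      fun X => by rw [tsum_mul_left, ((hsqk X).add (hsq X)).tsum_eq]
    have hTcont : Continuous T := by
      refine continuous_const.mul (continuous_of_dominated (bound := fun _ => CΨ ^ 2)
        (fun X => ((hg X).norm.pow 2).aestronglyMeasurable)
        (fun X => Eventually.of_forall fun s => ?_) (integrable_const _)
        (Eventually.of_forall fun s => (hcont.comp (continuous_id.add continuous_const)).norm.pow 2))
      rw [Real.norm_of_nonneg (sq_nonneg _)]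
      exact pow_le_pow_left₀ (norm_nonneg _) (hCΨ _) 2
    have hTle : ∀ X, ‖T X‖ ≤ (L ^ 3)⁻¹ * (CΨ ^ 2 * (volume.restrict (cell L) : Measure Space).real
        Set.univ) := fun X => by
      rw [hT, norm_mul, Real.norm_of_nonneg (inv_nonneg.2 (pow_nonneg hL.le 3))]
      refine mul_le_mul_of_nonneg_left (norm_integral_le_of_norm_le_const
        (Eventually.of_forall fun s => ?_)) (inv_nonneg.2 (pow_nonneg hL.le 3))
      rw [Real.norm_of_nonneg (sq_nonneg _)]
      exact pow_le_pow_left₀ (norm_nonneg _) (hCΨ _) 2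
    have hBint : Integrable (fun X => ∑' q, (N : ℝ) * (‖Φc (q + k) X‖ ^ 2 + ‖Φc q X‖ ^ 2))
        (volume.restrict (cellN N L)) := by
      rw [show (fun X => ∑' q, (N : ℝ) * (‖Φc (q + k) X‖ ^ 2 + ‖Φc q X‖ ^ 2)) =
        fun X => (N : ℝ) * (T X + T X) from funext htsum]
      refine Integrable.of_bound ((continuous_const.mul (hTcont.add hTcont)).aestronglyMeasurable)
        (N * (2 * ((L ^ 3)⁻¹ * (CΨ ^ 2 * (volume.restrict (cell L) : Measure Space).real
          Set.univ)))) (Eventually.of_forall fun X => ?_)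
      rw [norm_mul, Real.norm_natCast]
      refine mul_le_mul_of_nonneg_left ((norm_add_le _ _).trans ?_) (Nat.cast_nonneg N)
      linarith [hTle X]
    have hmain := hasSum_integral_of_dominated_convergence (μ := volume.restrict (cellN N L))
      (F := fun q X => conj (Φc (q + k) X) * (densityWave N L k X * Φc q X))
      (fun q X => (N : ℝ) * (‖Φc (q + k) X‖ ^ 2 + ‖Φc q X‖ ^ 2))
      (fun q => ((Complex.continuous_conj.comp (hcontq (q + k))).mul
        ((continuous_densityWave L k).mul (hcontq q))).aestronglyMeasurable)
      (fun q => Eventually.of_forall fun X => hbound q X) (Eventually.of_forall hsummable) hBint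
      (Eventually.of_forall hpt)
    -- the value: Fubini and the cell shift
    set H : Config N → ℂ := fun Y => densityWave N L k Y * (((‖Ψ.ψ Y‖ ^ 2 : ℝ)) : ℂ) with hH
    have hHc : Continuous H :=
      (continuous_densityWave L k).mul (Complex.continuous_ofReal.comp (hcont.norm.pow 2))
    have hHper : IsTorusPeriodic L H := fun X i a => by
      simp only [hH, secdec_densityWave_periodic hL.ne' k X i a, hper X i a]
    have hHle : ∀ X, ‖H X‖ ≤ N * CΨ ^ 2 := fun X => by
      rw [hH, norm_mul, Complex.norm_real, Real.norm_of_nonneg (sq_nonneg _)]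
      exact mul_le_mul (norm_densityWave_le L k X) (pow_le_pow_left₀ (norm_nonneg _) (hCΨ X) 2)
        (sq_nonneg _) (Nat.cast_nonneg N)
    have hrew : ∀ X, densityWave N L k X * (((L ^ 3)⁻¹ : ℝ) • ∫ s in cell L,
        cellWave L k s * (((‖Ψ.ψ (X + fun _ => s)‖ ^ 2 : ℝ)) : ℂ)) =
        ((L ^ 3)⁻¹ : ℝ) • ∫ s in cell L, H (X + fun _ => s) := fun X => by
      rw [mul_smul_comm, ← integral_const_mul]
      congr 1
      refine integral_congr_ae (Eventually.of_forall fun s => ?_)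
      simp only [hH, secdec_densityWave_add_const]
      ring
    have hval : ∫ X in cellN N L, densityWave N L k X * (((L ^ 3)⁻¹ : ℝ) • ∫ s in cell L,
        cellWave L k s * (((‖Ψ.ψ (X + fun _ => s)‖ ^ 2 : ℝ)) : ℂ)) =
        ∫ X in cellN N L, H X := by
      simp_rw [hrew]
      exact secdec_setIntegral_fibre_average hL hHc hHper hHle
    rw [hval] at hmain
    exact hmain

end

end Summit.AtomisticToContinuum.BoseEinsteinCondensation.Cruxes.StaticResponseBound.StableFractionSquareCompletion
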